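import Literature.AlgebraicGeometry.ModuliOfAbelianVarieties.SiegelCMSpecialPairPeriodIso
import HarnessLib

/-!
# The period lattice of a CM special pair under the period isomorphism: `e(Λ) = ∏ᵢ u(𝔞ᵢ)`;
# chart changes intertwining `J` with `√−1` are `ℂ`-linear ([Shimura 1998] §6.2; [Milne ISV] §4, Ex. 12.4 (b))

Topic `AlgebraicGeometry/ModuliOfAbelianVarieties`; namespace
`Literature.AlgebraicGeometry.ModuliOfAbelianVarieties.CMStructure`.  THEOREMS ONLY (no definition, no named fact, no
instance, no `sorry`; net Literature debt **0**).  Sequel of ★ R60-33 `SiegelCMSpecialPairPeriodIso` (`IsSpecial.exists_periodIso`: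
`e : (ℝ^{2g}, J, act) ≅ (∏ᵢ ℂ^{Φᵢ}, √−1, F)`, normalised `e(act(x)·v₀) = Ψ(x)`).  Cell hodgecm-mathlib (D-0151), banked GENERIC
leaf toward fan-B row I-7 (#60) `SiegelS1` (director g6 s86 (2)(b); A-p06's CENSUS-M3a e159c28d §4 rows «ℂ-linearity of `T`, `T′`»
(S, folklore) and the lattice conditions of the torus maps `χ` (down) / `θ` (up) of M3a-α).

WHAT IS PROVED.
* §1 `exists_complexLinear_chart_change` — FOLKLORE: two `ℝ`-linear charts `Ψ₁ : ℝ^{2g} ≃ W₁`, `Ψ₂ : ℝ^{2g} → W₂` into complex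
  vector spaces, both carrying a real operator `J` to `√−1`, differ by a `ℂ`-LINEAR map `T : W₁ →ₗ[ℂ] W₂`, `T ∘ Ψ₁ = Ψ₂`
  (so the period iso of ★ R60-33 compares `ℂ`-linearly with any other complex chart of the special point, e.g. a marking
  `ℝ^{2g} ≅ ℂ^g`).
* §2 for a chart `e` normalised at a cyclic vector `v₀` (`e(act(x)·v₀) = Ψ(x)`, `x ↦ act(x)·v₀` bijective):
  `exists_chart_ratCast_eq` (every rational vector reads `Ψ(x)`); `chart_ratCast_mem_pi_idealLattice_iff` +
  `exists_mem_chart_ratCast_eq_of_mem_pi_idealLattice` — if `Λ ⊂ ℚ^{2g}` pulls back to `∏ᵢ 𝔞ᵢ ⊂ F`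
  (`act(x)·v₀ ∈ Λ ↔ ∀ i, xᵢ ∈ 𝔞ᵢ`, e.g. ★ R60-35 `act_mem_latticeOfGL_iff` for `Λ_a = ℚ^{2g} ∩ a·ẑ^{2g}`) then `e` carries `Λ`
  ONTO `∏ᵢ u(𝔞ᵢ)`, `u(𝔞) = D(𝔞)` Shimura's lattice (★ `CMTypeLattice.idealLattice`), i.e. the torus `(ℝ^{2g}, J)/Λ` of the
  special point is `∏ᵢ ℂ^{Φᵢ}/u(𝔞ᵢ)` (the tori of ★ `CMTypeUniformization`, `periodIso (Φ i) (𝔞 i)`); and the one-sided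
  versions `chart_ratCast_apply_mem_idealLattice` («down»: `prᵢ(q⁻¹Λ) ⊆ 𝔟 ⇒ e(Λ)ᵢ ⊆ u(𝔟)`) and `chart_ratCast_act_single`
  («up»: `e(act(ιᵢ v)·v₀) = ιᵢ(u(v))`) for the lattice-sandwich case (★ R60-40a).
Nothing printed is asserted.  HC_CM is proved only modulo the 7 printed citations until rung 0 closes.

## References
* [Shimura1998] G. Shimura, *Abelian Varieties with Complex Multiplication and Modular Functions* (1998), §6.2 Thm. 3–4 pp. 42–45.
* [Milne2005ShimuraVarieties] J. S. Milne, *Introduction to Shimura varieties* (2005), §4 pp. 48–49 («`H₁ = V ∩ a·Λ̂`»), Ex. 12.4 (b) p. 112.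
* [Deligne1971TravauxShimura] P. Deligne, *Travaux de Shimura*, Sém. Bourbaki 389 (1971), 4.18–4.20 pp. 150–152.
* [Lange2023AbelianVarietiesComplex] H. Lange, *Abelian Varieties over the Complex Numbers* (2023), §1.1 (complex tori, `ℂ`-linear lifts).
-/

set_option autoImplicit false

noncomputable section

open scoped Classical nonZeroDivisors
open Matrix NumberField Module Function

namespace Literature.AlgebraicGeometry.ModuliOfAbelianVarieties

namespace CMStructure

open Literature.AlgebraicGeometry.Motives (CMType)
open Literature.NumberTheory.ComplexMultiplication (CMTypeLattice.cmEmbedding CMTypeLattice.cmEmbedding_apply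
  CMTypeLattice.idealLattice CMTypeLattice.mem_idealLattice_iff CMTypeLattice.cmEmbedding_injective
  CMTypeLattice.cmEmbedding_mem_idealLattice)

variable {g : ℕ} {δ : Fin g → ℕ} {ι : Type} [Fintype ι] [DecidableEq ι] {K : ι → Type} [∀ i, Field (K i)]
  [∀ i, NumberField (K i)] [∀ i, IsCMField (K i)]

/-! ### §1. `ℝ`-linear maps between complex vector spaces that intertwine `J` with `√−1` are `ℂ`-linear -/

omit [Fintype ι] [DecidableEq ι] [∀ i, NumberField (K i)] [∀ i, IsCMField (K i)] in
/-- **Chart changes are `ℂ`-linear.**  Let `J` act on `ℝ^{2g}` and let `Ψ₁ : ℝ^{2g} ≃ₗ[ℝ] W₁`, `Ψ₂ : ℝ^{2g} →ₗ[ℝ] W₂` be `ℝ`-linear maps to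
complex vector spaces carrying `J` to `√−1` (`Ψₖ(J·v) = √−1·Ψₖ(v)`).  Then the chart change `Ψ₂ ∘ Ψ₁⁻¹ : W₁ → W₂` is `ℂ`-LINEAR
(it is `ℝ`-linear and commutes with `√−1`).  Used for the period iso of ★ R60-33 against any other complex chart of the special point
(e.g. a marking `ℝ^{2g} ≅ ℂ^g`). [folklore] [cite: Lange2023AbelianVarietiesComplex, §1.1 (p0021)] -/
theorem exists_complexLinear_chart_change {n : Type} [Fintype n] (J : Matrix n n ℝ)
    {W₁ W₂ : Type} [AddCommGroup W₁] [Module ℂ W₁] [AddCommGroup W₂] [Module ℂ W₂]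
    (Ψ₁ : (n → ℝ) ≃ₗ[ℝ] W₁) (Ψ₂ : (n → ℝ) →ₗ[ℝ] W₂)
    (h₁ : ∀ v, Ψ₁ (J *ᵥ v) = Complex.I • Ψ₁ v) (h₂ : ∀ v, Ψ₂ (J *ᵥ v) = Complex.I • Ψ₂ v) :
    ∃ T : W₁ →ₗ[ℂ] W₂, ∀ v, T (Ψ₁ v) = Ψ₂ v := by
  -- the `ℝ`-linear chart change and its commutation with `√−1`
  have hI : ∀ w : W₁, Ψ₂ (Ψ₁.symm (Complex.I • w)) = Complex.I • Ψ₂ (Ψ₁.symm w) := by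
    intro w
    have hw : Complex.I • w = Ψ₁ (J *ᵥ Ψ₁.symm w) := by rw [h₁, LinearEquiv.apply_symm_apply]
    rw [hw, LinearEquiv.symm_apply_apply, h₂]
  refine ⟨{ toFun := fun w => Ψ₂ (Ψ₁.symm w)
            map_add' := fun w w' => by rw [map_add, map_add]
            map_smul' := fun z w => ?_ }, fun v => by
    change Ψ₂ (Ψ₁.symm (Ψ₁ v)) = Ψ₂ v
    rw [LinearEquiv.symm_apply_apply]⟩
  -- `z • w = re z • w + im z • (I • w)` with real scalars
  have hz : z • w = (z.re : ℂ) • w + (z.im : ℂ) • (Complex.I • w) := by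
    rw [smul_smul, ← add_smul, Complex.re_add_im]
  rw [RingHom.id_apply, hz, map_add, map_add, Complex.coe_smul, Complex.coe_smul, LinearEquiv.map_smul, LinearMap.map_smul,
    LinearEquiv.map_smul, LinearMap.map_smul, hI, ← Complex.coe_smul, ← Complex.coe_smul, smul_smul, ← add_smul,
    Complex.re_add_im]

/-! ### §2. The rational structure and lattices under a normalised chart -/

omit [DecidableEq ι] in
/-- **Every rational vector is an `F`-translate of the cyclic vector**, read through the chart: for `w ∈ ℚ^{2g}`,
`e(w) = Ψ(x)` for the unique `x ∈ F` with `act(x)·v₀ = w`. [cite: Deligne1971TravauxShimura, 4.18 p. 150] -/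
theorem exists_chart_ratCast_eq (c : CMStructure g δ ι K) (Φ : ∀ i, CMType (K i))
    (e : (Fin g ⊕ Fin g → ℝ) ≃ₗ[ℝ] (Π i, ((Φ i).1 → ℂ))) {v₀ : Fin g ⊕ Fin g → ℚ}
    (hv₀ : Function.Bijective fun x : Π i, K i => c.act x v₀)
    (he : ∀ x : Π i, K i, e ((algebraMap ℚ ℝ) ∘ (c.act x v₀)) = fun i => CMTypeLattice.cmEmbedding (Φ i) (x i))
    (w : Fin g ⊕ Fin g → ℚ) :
    ∃ x : Π i, K i, c.act x v₀ = w ∧ e ((algebraMap ℚ ℝ) ∘ w) = fun i => CMTypeLattice.cmEmbedding (Φ i) (x i) := by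
  obtain ⟨x, hx⟩ := hv₀.2 w
  exact ⟨x, hx, by rw [← he x, show c.act x v₀ = w from hx]⟩

omit [DecidableEq ι] in
/-- **THE PERIOD LATTICE OF A SPECIAL POINT IS `∏ᵢ u(𝔞ᵢ)`.**  Let `e` be a chart normalised at the cyclic vector `v₀` (★ R60-33 (c)) and
`Λ ⊂ ℚ^{2g}` a subgroup whose pull-back to `F` along `x ↦ act(x)·v₀` is the product of fractional ideals `∏ᵢ 𝔞ᵢ`
(`act(x)·v₀ ∈ Λ ↔ ∀ i, xᵢ ∈ 𝔞ᵢ`; for `Λ = Λ_a = ℚ^{2g} ∩ a·ẑ^{2g}` this is ★ R60-35 `act_mem_latticeOfGL_iff`).  Then `e` carries `Λ` ONTO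
the product of Shimura's lattices `D(𝔞ᵢ) = u(𝔞ᵢ) ⊂ ℂ^{Φᵢ}` (★ `CMTypeLattice.idealLattice`): membership (`mem`) and surjectivity (`surj`).
So the complex torus `(ℝ^{2g}, J)/Λ` of the special point is `∏ᵢ ℂ^{Φᵢ}/u(𝔞ᵢ)` — the product of the CM tori of ★ `CMTypeUniformization`
(`periodIso (Φ i) (𝔞 i)`). [cite: Shimura1998, §6.2 Thm. 4, p. 45] [cite: Milne2005ShimuraVarieties, §4 pp. 48–49 and Ex. 12.4 (b) p. 112]
[cite: Deligne1971TravauxShimura, 4.18–4.20 pp. 150–152] -/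
theorem chart_ratCast_mem_pi_idealLattice_iff (c : CMStructure g δ ι K) (Φ : ∀ i, CMType (K i))
    (e : (Fin g ⊕ Fin g → ℝ) ≃ₗ[ℝ] (Π i, ((Φ i).1 → ℂ))) {v₀ : Fin g ⊕ Fin g → ℚ}
    (hv₀ : Function.Bijective fun x : Π i, K i => c.act x v₀)
    (he : ∀ x : Π i, K i, e ((algebraMap ℚ ℝ) ∘ (c.act x v₀)) = fun i => CMTypeLattice.cmEmbedding (Φ i) (x i))
    (𝔞 : Π i, (FractionalIdeal (𝓞 (K i))⁰ (K i))ˣ) {Λ : Set (Fin g ⊕ Fin g → ℚ)}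
    (hΛ : ∀ x : Π i, K i, c.act x v₀ ∈ Λ ↔ ∀ i, x i ∈ ((𝔞 i : FractionalIdeal (𝓞 (K i))⁰ (K i)) : Set (K i)))
    (w : Fin g ⊕ Fin g → ℚ) :
    w ∈ Λ ↔ ∀ i, e ((algebraMap ℚ ℝ) ∘ w) i ∈ CMTypeLattice.idealLattice (Φ i) (𝔞 i) := by
  obtain ⟨x, rfl, hx⟩ := c.exists_chart_ratCast_eq Φ e hv₀ he w
  rw [hΛ, hx]
  refine forall_congr' fun i => ?_
  rw [CMTypeLattice.mem_idealLattice_iff]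
  constructor
  · exact fun h => ⟨x i, h, rfl⟩
  · rintro ⟨β, hβ, hβx⟩
    rwa [← CMTypeLattice.cmEmbedding_injective (Φ i) hβx]

omit [DecidableEq ι] in
/-- Surjectivity half of `chart_ratCast_mem_pi_idealLattice_iff`: every element of `∏ᵢ u(𝔞ᵢ)` is the image of a point of `Λ`.
[cite: Shimura1998, §6.2 Thm. 4, p. 45] [cite: Milne2005ShimuraVarieties, §4 pp. 48–49] -/
theorem exists_mem_chart_ratCast_eq_of_mem_pi_idealLattice (c : CMStructure g δ ι K) (Φ : ∀ i, CMType (K i))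
    (e : (Fin g ⊕ Fin g → ℝ) ≃ₗ[ℝ] (Π i, ((Φ i).1 → ℂ))) {v₀ : Fin g ⊕ Fin g → ℚ}
    (he : ∀ x : Π i, K i, e ((algebraMap ℚ ℝ) ∘ (c.act x v₀)) = fun i => CMTypeLattice.cmEmbedding (Φ i) (x i))
    (𝔞 : Π i, (FractionalIdeal (𝓞 (K i))⁰ (K i))ˣ) {Λ : Set (Fin g ⊕ Fin g → ℚ)}
    (hΛ : ∀ x : Π i, K i, c.act x v₀ ∈ Λ ↔ ∀ i, x i ∈ ((𝔞 i : FractionalIdeal (𝓞 (K i))⁰ (K i)) : Set (K i)))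
    {z : Π i, ((Φ i).1 → ℂ)} (hz : ∀ i, z i ∈ CMTypeLattice.idealLattice (Φ i) (𝔞 i)) :
    ∃ w ∈ Λ, e ((algebraMap ℚ ℝ) ∘ w) = z := by
  have hβ : ∀ i, ∃ β ∈ ((𝔞 i : FractionalIdeal (𝓞 (K i))⁰ (K i)) : Set (K i)), CMTypeLattice.cmEmbedding (Φ i) β = z i :=
    fun i => (CMTypeLattice.mem_idealLattice_iff (Φ i) (𝔞 i)).mp (hz i)
  choose β hβmem hβz using hβ
  refine ⟨c.act β v₀, (hΛ β).mpr hβmem, ?_⟩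
  rw [he]
  funext i
  exact hβz i

omit [DecidableEq ι] in
/-- **Lattice inclusions (the sandwich case)**: if the pull-back of `Λ` to `F` has `i`-th components in `𝔟` (`act(x)·v₀ ∈ Λ → xᵢ ∈ 𝔟`) then
the `i`-th component of `e(Λ)` lies in `u(𝔟)` — the «down» lattice condition of a torus map `(ℝ^{2g}, J)/Λ → ℂ^{Φᵢ}/u(𝔟)`.
[cite: Shimura1998, §6.2 Thm. 4, p. 45] [cite: Milne2005ShimuraVarieties, §4 pp. 48–49] -/
theorem chart_ratCast_apply_mem_idealLattice (c : CMStructure g δ ι K) (Φ : ∀ i, CMType (K i))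
    (e : (Fin g ⊕ Fin g → ℝ) ≃ₗ[ℝ] (Π i, ((Φ i).1 → ℂ))) {v₀ : Fin g ⊕ Fin g → ℚ}
    (hv₀ : Function.Bijective fun x : Π i, K i => c.act x v₀)
    (he : ∀ x : Π i, K i, e ((algebraMap ℚ ℝ) ∘ (c.act x v₀)) = fun i => CMTypeLattice.cmEmbedding (Φ i) (x i))
    {Λ : Set (Fin g ⊕ Fin g → ℚ)} (i : ι) (𝔟 : (FractionalIdeal (𝓞 (K i))⁰ (K i))ˣ)
    (hΛ : ∀ x : Π i, K i, c.act x v₀ ∈ Λ → x i ∈ ((𝔟 : FractionalIdeal (𝓞 (K i))⁰ (K i)) : Set (K i)))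
    {w : Fin g ⊕ Fin g → ℚ} (hw : w ∈ Λ) :
    e ((algebraMap ℚ ℝ) ∘ w) i ∈ CMTypeLattice.idealLattice (Φ i) 𝔟 := by
  obtain ⟨x, rfl, hx⟩ := c.exists_chart_ratCast_eq Φ e hv₀ he w
  rw [hx]
  exact CMTypeLattice.cmEmbedding_mem_idealLattice (Φ i) 𝔟 (hΛ x hw)

/-- **The «up» direction**: the chart image of `act(ιᵢ v)·v₀` is the elementary vector `ιᵢ(u(v))` — so if `act(ιᵢ(𝔟))·v₀ ⊆ Λ` the
`i`-th coordinate inclusion `ℂ^{Φᵢ} ↪ ∏ⱼ ℂ^{Φⱼ}` carries `u(𝔟)` into `e(Λ)` (the lattice condition of a torus map `ℂ^{Φᵢ}/u(𝔟) → (ℝ^{2g}, J)/Λ`).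
[cite: Shimura1998, §6.2 Thm. 4, p. 45] [cite: Milne2005ShimuraVarieties, §4 pp. 48–49] -/
theorem chart_ratCast_act_single (c : CMStructure g δ ι K) (Φ : ∀ i, CMType (K i))
    (e : (Fin g ⊕ Fin g → ℝ) ≃ₗ[ℝ] (Π i, ((Φ i).1 → ℂ))) {v₀ : Fin g ⊕ Fin g → ℚ}
    (he : ∀ x : Π i, K i, e ((algebraMap ℚ ℝ) ∘ (c.act x v₀)) = fun i => CMTypeLattice.cmEmbedding (Φ i) (x i))
    (i : ι) (v : K i) :
    e ((algebraMap ℚ ℝ) ∘ (c.act (Pi.single i v) v₀)) = Pi.single i (CMTypeLattice.cmEmbedding (Φ i) v) := by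
  rw [he]
  funext j
  by_cases hj : j = i
  · subst hj
    rw [Pi.single_eq_same, Pi.single_eq_same]
  · rw [Pi.single_eq_of_ne hj, Pi.single_eq_of_ne hj, map_zero]

end CMStructure

end Literature.AlgebraicGeometry.ModuliOfAbelianVarieties

end
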